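import Literature.NumberTheory.Irrationality.PAdicZetaValues.HurwitzLemma27TwoProofs
import Literature.NumberTheory.Irrationality.PAdicZetaValues.HurwitzLemma27Proofs
import HarnessLib

/-!
# Lai 2025, Lemma 2.7 at `p = 2`, verbatim, and the reflection `ζ_2(j, ¾) = ζ_2(j, ¼)` as a COROLLARY

L. Lai, *On the irrationality of certain 2-adic zeta values*, Int. J. Number Theory 21 (2025) =
arXiv:2304.00816 [Lai2025TwoAdicZeta], §2.3: "Moreover, we have the reflection formula [Coh07]:
`ζ_p(s, x) = ζ_p(s, 1 − x)`", and Lemma 2.7: "`ζ_p(j) = (1/q_p) Σ_{a=0, p∤a}^{q_p−1} ω(a)^{1−j} ζ_p(j, a/q_p)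
= (2/q_p) Σ_{0<a<q_p/2} ω(a)^{1−j} ζ_p(j, a/q_p)`.  In particular … `ζ_2(j) = ½ ζ_2(j, ¼)`."

HONEST RELATION between the tree's two discharges (`HurwitzLemma27Proofs.lai2025TwoAdic_lemma27_holds`,
every prime, the FIRST display; `HurwitzLemma27TwoProofs.lai2025TwoAdic_lemma27_two_holds`, the "in
particular" clause): the `p = 2` INSTANCE of the first display is NOT the clause verbatim — it reads
`ζ_2(j) = ¼ (ω(1)^{1−j} ζ_2(j, ¼) + ω(3)^{1−j} ζ_2(j, ¾))` with `ω(1) = 1`, `ω(3) = −1` in `ℤ_2`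
(`padicZetaValue_two_eq_quarter_add_three_quarters` below: `= ¼(ζ_2(j,¼) + ζ_2(j,¾))` for odd `j`), and the
two agree exactly through the reflection `ζ_2(j, ¾) = ζ_2(j, 1 − ¼) = ζ_2(j, ¼)`.  The general proof used
no reflection (the interpolation was proved class by class); the `p = 2` proof used Robert's
`σ : t ↦ −1 − t` symmetry at the level of the polynomials `(4t+1)^m ↔ (4t+3)^m`.  Putting the two
theorems side by side therefore PROVES this instance of the printed reflection formula for the typed
`padicHurwitzZeta` (`padicHurwitzZeta_two_three_quarters_eq_quarter`) — a consistency check of the two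
routes, not an independent proof of [Coh07]'s reflection formula.

Theorems only; statement files untouched.
Cell pub-zeta5 (HONEST FRAMING: systematic search; no irrationality claim unless kernel-certified):
`2`-adic bookkeeping; nothing here bears on `ζ(5) ∈ ℝ`.
-/

noncomputable section

open Filter Finset
open scoped Topology

namespace Literature.NumberTheory.Irrationality.PAdicZetaValues

/-- `q_2 = 4`. [cite: Lai2025TwoAdicZeta, §2.3 ("`q_2 = 4`")] -/
theorem qp_two : qp 2 = 4 := by
  rw [qp, if_pos rfl]

/-- `ω(1) = 1` in `ℚ_2`. [cite: Lai2025TwoAdicZeta, §2.3 (Teichmüller character; at `p = 2`, `ω(1) = 1`)] -/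
theorem teichmuller_two_one : teichmuller 2 ((1 : ℕ) : ℚ_[2]) = 1 := by
  rw [teichmuller_natCast_of_not_dvd (p := 2) (a := 1) (by norm_num), teichmullerUnit_two]
  simp

/-- `ω(3) = −1` in `ℚ_2` (`3 ≡ −1 (mod 4)`). [cite: Lai2025TwoAdicZeta, §2.3 (Teichmüller character; `μ_2(ℤ_2) = {±1}`)] -/
theorem teichmuller_two_three : teichmuller 2 ((3 : ℕ) : ℚ_[2]) = -1 := by
  rw [teichmuller_natCast_of_not_dvd (p := 2) (a := 3) (by norm_num), teichmullerUnit_two]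
  have h2 : ‖(2 : ℚ_[2])‖ = 2⁻¹ := by simpa using Padic.norm_p (p := 2)
  have h : ¬ (‖((3 : ℕ) : ℚ_[2]) - 1‖ < 2⁻¹) := by
    push_cast
    rw [show (3 : ℚ_[2]) - 1 = 2 by norm_num, h2]
    exact lt_irrefl _
  rw [if_neg h]

/-- **Lemma 2.7, first display, at `p = 2` (odd `j ≥ 3`):** `ζ_2(j) = ¼ (ζ_2(j, ¼) + ζ_2(j, ¾))`
(`q_2 = 4`, unit classes `a = 1, 3`, `ω(1)^{1−j} = ω(3)^{1−j} = 1` as `1 − j` is even) — the instance of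
`lai2025TwoAdic_lemma27_holds`. [cite: Lai2025TwoAdicZeta, Lemma 2.7 (§2.3), first display at `p = 2`] -/
theorem padicZetaValue_two_eq_quarter_add_three_quarters {j : ℕ} (hj : Odd j) (hj3 : 3 ≤ j) :
    padicZetaValue 2 j = (1 / 4 : ℚ_[2]) *
      (padicHurwitzZeta 2 j ((1 : ℚ_[2]) / 4) + padicHurwitzZeta 2 j ((3 : ℚ_[2]) / 4)) := by
  have h := lai2025TwoAdic_lemma27_holds 2 j hj hj3
  rw [qp_two, show (Finset.range 4).filter (fun a => ¬ 2 ∣ a) = {1, 3} by decide,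
    Finset.sum_pair (by norm_num), teichmuller_two_one, teichmuller_two_three, one_zpow] at h
  have heven : Even (1 - (j : ℤ)) := by
    obtain ⟨k, rfl⟩ := hj
    exact ⟨-(k : ℤ), by push_cast; ring⟩
  rw [heven.neg_one_zpow] at h
  rw [h]
  push_cast
  ring

/-- **The reflection `ζ_2(j, ¾) = ζ_2(j, ¼)` for odd `j ≥ 3`** (the instance `x = ¼` of "`ζ_p(s, x) =
ζ_p(s, 1 − x)`"), DERIVED by comparing the two discharged forms of Lemma 2.7: `¼(ζ_2(j,¼) + ζ_2(j,¾))
= ζ_2(j) = ½ ζ_2(j,¼)`. [cite: Lai2025TwoAdicZeta, §2.3 (reflection formula (2.1), at `p = 2`, `x = ¼`) and Lemma 2.7] -/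
theorem padicHurwitzZeta_two_three_quarters_eq_quarter {j : ℕ} (hj : Odd j) (hj3 : 3 ≤ j) :
    padicHurwitzZeta 2 j ((3 : ℚ_[2]) / 4) = padicHurwitzZeta 2 j ((1 : ℚ_[2]) / 4) := by
  have h1 := padicZetaValue_two_eq_quarter_add_three_quarters hj hj3
  have h2 := lai2025TwoAdic_lemma27_two_holds j hj hj3
  rw [one_div (4 : ℚ_[2])] at h1 ⊢
  rw [h2] at h1
  linear_combination (-4 : ℚ_[2]) * h1

end Literature.NumberTheory.Irrationality.PAdicZetaValues
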